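import Literature.ModelTheory.ExponentialFields.LastRootConjecture
import Literature.ModelTheory.ExponentialFields.RealExpTransfer
import Literature.ModelTheory.ExponentialFields.OMinimalExamples
import Mathlib.Analysis.Calculus.InverseFunctionTheorem.FDeriv
import Mathlib.Analysis.Calculus.FDeriv.Pi
import Mathlib.LinearAlgebra.Matrix.ToLin
import Mathlib.ModelTheory.Definability
import Mathlib.Topology.Algebra.Module.FiniteDimension
import Mathlib.SetTheory.Cardinal.Continuum
import Mathlib.Analysis.Real.Cardinality
import HarnessLib

/-!
# The Last Root Conjecture without effectivity: o-minimality bounds the non-singular zeros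

Family `periods` (trunk T-TRANSCEND, group G06), topic `Literature/ModelTheory/ExponentialFields`,
companion to `LastRootConjecture.lean` (Macintyre–Wilkie 1996 as reported by Berarducci–Servi
2004, p. 44: the decidability of `Th(ℝ_exp)` is equivalent to the *Last Root Conjecture*
`Literature.ModelTheory.ExponentialFields.LastRootConjecture` — a **computable** bound, as a function of an `n × n` system of
exponential polynomials over `ℤ`, on the norm of its non-singular real zeros).

Berarducci–Servi add (ibid.): "by Khovanskii's results there are computable upper bounds on the
cardinality of the set of solutions, but not necessarily on their norms". This file proves, in
Lean, the non-effective statement behind that remark from the o-minimality of `ℝ_exp` (Wilkie's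
theorem, the named fact `Literature.ModelTheory.ExponentialFields.wilkie_isOMinimal` of `RealExpField.lean`) instead of Khovanskii's
theorem:

* `Literature.ModelTheory.ExponentialFields.ExpPolyCode.exists_bound_isNonsingularZero` (**proved**): if `ℝ_exp` is o-minimal then
  for every `n` and every `n × n` system `F` of exponential polynomials over `ℤ` there is an
  `η ∈ ℕ` with `‖ā‖ < η` for every non-singular zero `ā ∈ ℝⁿ` of `F`
  (`Literature.ModelTheory.ExponentialFields.exists_bound_isNonsingularZero_of_wilkie_isOMinimal` is the same with the named fact as
  hypothesis). What this lacks with respect to `Literature.ModelTheory.ExponentialFields.LastRootConjecture` is exactly the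
  *computability* of `η` as a function of `F` (the bound is per system in both).

The proof is the textbook one and everything in it is proved here, on top of the calculus of
exponential terms of `Wilkie1989.lean` / `RealExpTransfer.lean`:

1. (`### Exponential polynomials as terms`) the code of an exponential polynomial gives a term of
   the language of ordered exponential rings at any tuple of terms standing for the coordinates
   (`evalTermX`, with `realize` lemma), in particular the rows `rowTerm n F i` of the system as
   terms in the coordinate variables;
2. (`### The Jacobian`) the Jacobian matrix `jac n F x` is the matrix of realizations of the
   *formal* partial derivatives `RealExpModel.termPDeriv j (rowTerm n F i)` (Wilkie 1989); by
   `RealExpModel.fderiv_realize_single` it is the matrix of the Fréchet derivative of the map of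
   the system, so the determinant in `Literature.ModelTheory.ExponentialFields.ExpPolyCode.IsNonsingularZero` is its determinant
   (`det_fderiv_sysMap`) and a zero is non-singular iff the Jacobian matrix has a left inverse
   (`isNonsingularZero_iff`);
3. (`### One encoding`) with bound variables `x̄` (coordinates) and `B` (an `n × n` matrix,
   indexed through `finProdFinEquiv`) at depth `n + n·n`, the bounded formulas `zeroB`
   ("`F(x̄) = 0`"), `invB` ("`B · Jac F(x̄) = 1`", with `termPDeriv`), `nonsingB = zeroB ⊓ invB`,
   `boundB` ("`x̄ ∈ [-η, η]ⁿ`") and the sentences `σ_{F,η} = ∀ x̄ B, nonsingB → boundB`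
   (`sigma n F η`), with their semantics (`realize_sigma_iff`: all non-singular zeros of the
   system padded to `n` rows have coordinates of absolute value `≤ η`; the key step
   `realize_termPDeriv_rowTermB` identifies the formal derivative at the deeper variables with
   the Jacobian entry by uniqueness of derivatives);
4. (`### Definability`) the set of non-singular zeros of `F` is definable in `ℝ_exp` *without
   parameters* — it is the projection to `x̄` of the set defined by `nonsingB`
   (`Set.Definable.image_comp`) — and so are its coordinate projections;
5. (`### Analysis`) by the inverse function theorem (`HasStrictFDerivAt.eventually_left_inverse`)
   a non-singular zero is isolated among the zeros, so the non-singular zeros form a countable set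
   (`countable_setOf_isNonsingularZero`: the half-radius isolating balls are pairwise disjoint
   open sets in a separable space);
6. (`### O-minimality`) in an o-minimal expansion of `(ℝ, <)` a countable parametrically definable
   subset of the line is bounded (`bddAbove_and_bddBelow_of_isOMinimal`: a finite union of points
   and intervals is eventually constant at `±∞` —
   `IsFiniteUnionOfIntervals.eventually_mem_or_eventually_notMem` of `OMinimalExamples.lean` and
   its twin at `-∞` proved here — and a ray of `ℝ` is uncountable, `Cardinal.mk_Ici_real`);
7. hence each coordinate of the non-singular zeros of `F` is bounded, whence the sup norm
   (`exists_bound_isNonsingularZero`); consequently some `σ_{F,η}` is true for every `F`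
   (`exists_realize_sigma`), and a true `σ_{F,η}` bounds the sup norm of the non-singular zeros of
   `F` by `η + 1` (`norm_lt_of_realize_sigma`) — the form used by the decision-theoretic half
   (`LastRootConjectureOfDecidable.lean`).

## References

* A. Berarducci, T. Servi, *An effective version of Wilkie's theorem of the complement and some
  effective o-minimality results*, Ann. Pure Appl. Logic 125 (2004), 43–74, p. 44.
* A. Macintyre, A. J. Wilkie, *On the decidability of the real exponential field*, in:
  Kreiseliana, A K Peters (1996), 441–467.
* A. J. Wilkie, *On the theory of the real exponential field*, Illinois J. Math. 33 (1989), §1,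
  p. 385 (formal partial derivatives of exponential terms).
* L. van den Dries, *Tame topology and o-minimal structures*, LMS Lecture Note Ser. 248 (1998),
  Ch. 1, (3.2) and Ch. 3 (definable discrete sets in o-minimal structures are finite).
-/

noncomputable section

open scoped BigOperators

namespace Literature.ModelTheory.ExponentialFields

namespace ExpPolyCode

open FirstOrder FirstOrder.Language RealExpModel

/-! ### Exponential polynomials as terms of the language of ordered exponential rings -/

section Terms

variable {α : Type*}

/-- the numeral `k` [folklore] -/
def natTerm : ℕ → Language.orderedExpRing.Term α
  | 0 => 0
  | k + 1 => natTerm k + 1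

/-- Numerals realize to the corresponding natural numbers. [folklore] -/
@[simp] theorem realize_natTerm (v : α → ℝ) : ∀ k : ℕ, (natTerm k : Language.orderedExpRing.Term α).realize v = k
  | 0 => by simp [natTerm]
  | k + 1 => by simp [natTerm, realize_natTerm v k]

/-- the integer numeral `c` [folklore] -/
def intTerm : ℤ → Language.orderedExpRing.Term α
  | Int.ofNat k => natTerm k
  | Int.negSucc k => -natTerm (k + 1)

/-- Integer numerals realize to the corresponding integers. [folklore] -/
@[simp] theorem realize_intTerm (v : α → ℝ) : ∀ c : ℤ, (intTerm c : Language.orderedExpRing.Term α).realize v = c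
  | Int.ofNat k => by simp [intTerm]
  | Int.negSucc k => by simp [intTerm, Int.negSucc_eq]

/-- the power `t ^ k` [folklore] -/
def powTerm (t : Language.orderedExpRing.Term α) : ℕ → Language.orderedExpRing.Term α
  | 0 => 1
  | k + 1 => powTerm t k * t

/-- Power terms realize to powers. [folklore] -/
@[simp] theorem realize_powTerm (v : α → ℝ) (t : Language.orderedExpRing.Term α) :
    ∀ k : ℕ, (powTerm t k).realize v = t.realize v ^ k
  | 0 => by simp [powTerm]
  | k + 1 => by simp [powTerm, realize_powTerm v t k, pow_succ]

/-- the product of a list of terms [folklore] -/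
def prodTerm : List (Language.orderedExpRing.Term α) → Language.orderedExpRing.Term α
  | [] => 1
  | t :: l => t * prodTerm l

/-- Product terms realize to products. [folklore] -/
@[simp] theorem realize_prodTerm (v : α → ℝ) :
    ∀ l : List (Language.orderedExpRing.Term α), (prodTerm l).realize v = (l.map fun t => t.realize v).prod
  | [] => by simp [prodTerm]
  | t :: l => by simp [prodTerm, realize_prodTerm v l]

/-- the sum of a list of terms [folklore] -/
def sumTerm : List (Language.orderedExpRing.Term α) → Language.orderedExpRing.Term α
  | [] => 0
  | t :: l => t + sumTerm l

/-- Sum terms realize to sums. [folklore] -/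
@[simp] theorem realize_sumTerm (v : α → ℝ) :
    ∀ l : List (Language.orderedExpRing.Term α), (sumTerm l).realize v = (l.map fun t => t.realize v).sum
  | [] => by simp [sumTerm]
  | t :: l => by simp [sumTerm, realize_sumTerm v l]

/-- the monomial factor `t^a (exp t)^b` [folklore] -/
def factorTerm (a b : ℕ) (t : Language.orderedExpRing.Term α) : Language.orderedExpRing.Term α :=
  powTerm t a * powTerm (Language.orderedExpRing.termExp t) b

/-- `factorTerm a b t` realizes to `t^a (e^t)^b` at the value of `t`. [folklore] -/
@[simp] theorem realize_factorTerm (v : α → ℝ) (a b : ℕ) (t : Language.orderedExpRing.Term α) :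
    (factorTerm a b t).realize v = t.realize v ^ a * Real.exp (t.realize v) ^ b := by
  simp [factorTerm]

variable (n : ℕ)

/-- the term of a monomial at a tuple of terms `xs` (to be the coordinate variables) [folklore] -/
def monoTermX (xs : Fin n → Language.orderedExpRing.Term α) (m : ℤ × List ℕ) :
    Language.orderedExpRing.Term α :=
  (intTerm m.1 : Language.orderedExpRing.Term α) *
    prodTerm ((List.finRange n).map fun i : Fin n =>
      factorTerm (m.2.getD (i : ℕ) 0) (m.2.getD (n + (i : ℕ)) 0) (xs i))

/-- The term of a monomial realizes to the value of the monomial at the values of `xs`. [folklore] -/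
@[simp] theorem realize_monoTermX (v : α → ℝ) (xs : Fin n → Language.orderedExpRing.Term α)
    (m : ℤ × List ℕ) :
    (monoTermX n xs m).realize v = monomialEval n m (fun i => (xs i).realize v) := by
  rw [monomialEval, Fin.prod_univ_def]
  simp only [monoTermX, Language.orderedExpRing.realize_mul, realize_intTerm, realize_prodTerm,
    List.map_map]
  congr 2
  exact List.map_congr_left fun i _ => by simp

/-- the term of an exponential polynomial code at a tuple of terms `xs` [folklore] -/
def evalTermX (xs : Fin n → Language.orderedExpRing.Term α) : ExpPolyCode → Language.orderedExpRing.Term α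
  | [] => 0
  | m :: p => monoTermX n xs m + evalTermX xs p

/-- The term of a code realizes to the value of the exponential polynomial at the values of
`xs`. [folklore] -/
@[simp] theorem realize_evalTermX (v : α → ℝ) (xs : Fin n → Language.orderedExpRing.Term α) :
    ∀ p : ExpPolyCode, (evalTermX n xs p).realize v = eval n p (fun i => (xs i).realize v)
  | [] => by simp [evalTermX, eval]
  | m :: p => by simp [evalTermX, eval, realize_evalTermX v xs p]

end Terms

/-! ### The Jacobian through the formal partial derivatives of `Wilkie1989.lean` -/

section Jacobian

variable (n : ℕ) (F : List ExpPolyCode)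

/-- the `i`-th row of the system as a term in the coordinate variables `Fin n` (no parameters) [folklore] -/
def rowTerm (i : Fin n) : Language.orderedExpRing.Term (Empty ⊕ Fin n) :=
  evalTermX n (fun j => var (Sum.inr j)) (F.getD (i : ℕ) [])

/-- The row terms realize to the rows of the system. [folklore] -/
@[simp] theorem realize_rowTerm (v : Empty → ℝ) (x : Fin n → ℝ) (i : Fin n) :
    (rowTerm n F i).realize (Sum.elim v x) = eval n (F.getD (i : ℕ) []) x := by
  simp [rowTerm]

/-- The map of the system is the realization of the row terms. [folklore] -/
theorem sysMap_eq_realize : sysMap n F = fun x i => (rowTerm n F i).realize (Sum.elim Empty.elim x) := by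
  funext x i
  rw [realize_rowTerm]; rfl

/-- the formal partial derivative `∂(row i)/∂x_j` (`RealExpModel.termPDeriv`) [cite: Wilkie1989, §1, p. 385] -/
def pdTerm (i j : Fin n) : Language.orderedExpRing.Term (Empty ⊕ Fin n) :=
  termPDeriv j (rowTerm n F i)

/-- the Jacobian matrix of the system at a point: realizations of the formal partial derivatives [cite: Wilkie1989, §1, p. 385] -/
def jac (x : Fin n → ℝ) : Matrix (Fin n) (Fin n) ℝ :=
  Matrix.of fun i j => (pdTerm n F i j).realize (Sum.elim Empty.elim x)

/-- **The matrix of the Fréchet derivative of the system is the Jacobian matrix of formal partial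
derivatives** (`fderiv_pi` and `RealExpModel.fderiv_realize_single`, Wilkie 1989, p. 385). [cite: Wilkie1989, §1, p. 385] -/
theorem toMatrix'_fderiv_sysMap (x : Fin n → ℝ) :
    LinearMap.toMatrix' (fderiv ℝ (sysMap n F) x : (Fin n → ℝ) →ₗ[ℝ] (Fin n → ℝ)) = jac n F x := by
  ext i j
  rw [LinearMap.toMatrix'_apply, ContinuousLinearMap.coe_coe, sysMap_eq_realize,
    fderiv_pi fun i => ((RealExpModel.contDiff_realize (rowTerm n F i) Empty.elim
      (n := 1)).differentiable (by simp)).differentiableAt]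
  rw [ContinuousLinearMap.pi_apply, RealExpModel.fderiv_realize_single]
  rfl

/-- the determinant in `IsNonsingularZero` is the Jacobian determinant [folklore] -/
theorem det_fderiv_sysMap (x : Fin n → ℝ) :
    LinearMap.det (fderiv ℝ (sysMap n F) x : (Fin n → ℝ) →ₗ[ℝ] (Fin n → ℝ)) = (jac n F x).det := by
  rw [← LinearMap.det_toMatrix', toMatrix'_fderiv_sysMap]

/-- non-singular zeros, algebraically: common zeros at which the Jacobian matrix has a left inverse [folklore] -/
theorem isNonsingularZero_iff (a : Fin n → ℝ) :
    IsNonsingularZero n F a ↔ F.length = n ∧ (∀ i : Fin n, eval n (F.getD i []) a = 0) ∧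
      ∃ B : Matrix (Fin n) (Fin n) ℝ, B * jac n F a = 1 := by
  unfold IsNonsingularZero
  rw [det_fderiv_sysMap, ← isUnit_iff_ne_zero, ← Matrix.isUnit_iff_isUnit_det, isUnit_iff_exists_inv']
  simp only [funext_iff, sysMap, Pi.zero_apply]

end Jacobian

/-! ### One encoding: bounded formulas at depth `n + n·n` (coordinates `x̄`, matrix entries `B`) -/

section Formulas

variable (n : ℕ)

/-- the bound variable of the coordinate `x_i`, at depth `n + n·n` [folklore] -/
def xv (i : Fin n) : Language.orderedExpRing.Term (Empty ⊕ Fin (n + n * n)) :=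
  var (Sum.inr (Fin.castAdd (n * n) i))

/-- the bound variable of the matrix entry `B i j`, at depth `n + n·n` (Mathlib's `finProdFinEquiv`) [folklore] -/
def bv (i j : Fin n) : Language.orderedExpRing.Term (Empty ⊕ Fin (n + n * n)) :=
  var (Sum.inr (Fin.natAdd n (finProdFinEquiv (i, j))))

/-- conjunction of a list of bounded formulas [folklore] -/
def andL {k : ℕ} : List (Language.orderedExpRing.BoundedFormula Empty k) →
    Language.orderedExpRing.BoundedFormula Empty k
  | [] => ⊤
  | φ :: l => φ ⊓ andL l

/-- `andL l` holds iff every member of `l` holds. [folklore] -/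
theorem realize_andL {k : ℕ} (v : Empty → ℝ) (xs : Fin k → ℝ) :
    ∀ l : List (Language.orderedExpRing.BoundedFormula Empty k),
      (andL l).Realize v xs ↔ ∀ φ ∈ l, φ.Realize v xs
  | [] => by simp [andL]
  | φ :: l => by
    rw [andL, BoundedFormula.realize_inf, realize_andL v xs l]
    simp

/-- `andL (l.map f)` holds iff `f i` holds for every `i ∈ l`. [folklore] -/
theorem realize_andL_map {k : ℕ} (v : Empty → ℝ) (xs : Fin k → ℝ) {ι : Type*} (l : List ι)
    (f : ι → Language.orderedExpRing.BoundedFormula Empty k) :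
    (andL (l.map f)).Realize v xs ↔ ∀ i ∈ l, (f i).Realize v xs := by
  rw [realize_andL]
  simp

variable (F : List ExpPolyCode) (η : ℕ)

/-- the `i`-th row at the coordinate variables of depth `n + n·n` [folklore] -/
def rowTermB (i : Fin n) : Language.orderedExpRing.Term (Empty ⊕ Fin (n + n * n)) :=
  evalTermX n (xv n) (F.getD (i : ℕ) [])

/-- "`x̄` is a common zero of `F`" [folklore] -/
def zeroB : Language.orderedExpRing.BoundedFormula Empty (n + n * n) :=
  andL ((List.finRange n).map fun i : Fin n => Term.bdEqual (rowTermB n F i) 0)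

/-- the `(i, k)` entry of "`B · Jac F(x̄) = 1`", with the formal partial derivatives `termPDeriv` [folklore] -/
def invEntryB (i k : Fin n) : Language.orderedExpRing.BoundedFormula Empty (n + n * n) :=
  Term.bdEqual
    (sumTerm ((List.finRange n).map fun j : Fin n =>
      bv n i j * termPDeriv (Fin.castAdd (n * n) k) (rowTermB n F j)))
    (if i = k then 1 else 0)

/-- "`B · Jac F(x̄) = 1`" [folklore] -/
def invB : Language.orderedExpRing.BoundedFormula Empty (n + n * n) :=
  andL ((List.finRange n).map fun i : Fin n => andL ((List.finRange n).map fun k : Fin n => invEntryB n F i k))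

/-- "`x̄` is a common zero of `F` and `B` is a left inverse of the Jacobian at `x̄`" [folklore] -/
def nonsingB : Language.orderedExpRing.BoundedFormula Empty (n + n * n) :=
  zeroB n F ⊓ invB n F

/-- "`-η ≤ x_i ≤ η` for all `i`" [folklore] -/
def boundB : Language.orderedExpRing.BoundedFormula Empty (n + n * n) :=
  andL ((List.finRange n).map fun i : Fin n => ((-natTerm η).le (xv n i)) ⊓ ((xv n i).le (natTerm η)))

/-- the matrix of `σ_{F,η}` [folklore] -/
def chi : Language.orderedExpRing.BoundedFormula Empty (n + n * n) :=
  nonsingB n F ⟹ boundB n η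

/-- **The sentence `σ_{F,η}`**: every common zero of `F` at which the Jacobian has a left inverse
has all coordinates in `[-η, η]`. [folklore] -/
def sigma : Language.orderedExpRing.Sentence :=
  (chi n F η).alls

/-! #### Semantics -/

variable {n F η}

/-- the coordinates `ā` of a valuation of the bound variables [folklore] -/
def coordOf (xs : Fin (n + n * n) → ℝ) : Fin n → ℝ := fun i => xs (Fin.castAdd (n * n) i)

/-- the matrix `B` of a valuation of the bound variables [folklore] -/
def matOf (xs : Fin (n + n * n) → ℝ) : Matrix (Fin n) (Fin n) ℝ :=
  Matrix.of fun i j : Fin n => xs (Fin.natAdd n (finProdFinEquiv (i, j)))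

/-- the valuation `(ā, B)` [folklore] -/
def valOf (a : Fin n → ℝ) (B : Matrix (Fin n) (Fin n) ℝ) : Fin (n + n * n) → ℝ :=
  Fin.append a fun m => B (finProdFinEquiv.symm m).1 (finProdFinEquiv.symm m).2

/-- The coordinates of the valuation `(ā, B)` are `ā`. [folklore] -/
@[simp] theorem coordOf_valOf (a : Fin n → ℝ) (B : Matrix (Fin n) (Fin n) ℝ) : coordOf (valOf a B) = a := by
  funext i; simp [coordOf, valOf]

/-- The matrix of the valuation `(ā, B)` is `B`. [folklore] -/
@[simp] theorem matOf_valOf (a : Fin n → ℝ) (B : Matrix (Fin n) (Fin n) ℝ) : matOf (valOf a B) = B := by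
  ext i j
  simp only [matOf, valOf, Matrix.of_apply, Fin.append_right, Equiv.symm_apply_apply]

/-- Every valuation is `(ā, B)` for its coordinates and matrix. [folklore] -/
theorem valOf_coordOf_matOf (xs : Fin (n + n * n) → ℝ) : valOf (coordOf xs) (matOf xs) = xs := by
  funext m
  refine Fin.addCases (fun i => ?_) (fun j => ?_) m
  · simp [valOf, coordOf]
  · simp only [valOf, matOf, Fin.append_right, Matrix.of_apply, Prod.mk.eta, Equiv.apply_symm_apply]

/-- The coordinate variables realize to the coordinates. [folklore] -/
theorem realize_xv (v : Empty → ℝ) (xs : Fin (n + n * n) → ℝ) (i : Fin n) :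
    (xv n i).realize (Sum.elim v xs) = coordOf xs i := by
  simp [xv, coordOf]

/-- The matrix variables realize to the matrix entries. [folklore] -/
theorem realize_bv (v : Empty → ℝ) (xs : Fin (n + n * n) → ℝ) (i j : Fin n) :
    (bv n i j).realize (Sum.elim v xs) = matOf xs i j := by
  simp [bv, matOf]

/-- The row terms at the deeper variables realize to the rows at the coordinates. [folklore] -/
theorem realize_rowTermB (v : Empty → ℝ) (xs : Fin (n + n * n) → ℝ) (i : Fin n) :
    (rowTermB n F i).realize (Sum.elim v xs) = eval n (F.getD (i : ℕ) []) (coordOf xs) := by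
  simp [rowTermB, realize_xv]

/-- **the formal partial derivative at the coordinate variables of depth `n + n·n` realizes to the
Jacobian entry** (both are the derivative of the same one-variable function) [folklore] -/
theorem realize_termPDeriv_rowTermB (v : Empty → ℝ) (xs : Fin (n + n * n) → ℝ) (j k : Fin n) :
    (termPDeriv (Fin.castAdd (n * n) k) (rowTermB n F j)).realize (Sum.elim v xs) =
      jac n F (coordOf xs) j k := by
  have h1 := hasDerivAt_realize_termPDeriv v xs (Fin.castAdd (n * n) k) (rowTermB n F j)
  have h2 := hasDerivAt_realize_termPDeriv (Empty.elim : Empty → ℝ) (coordOf xs) k (rowTerm n F j)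
  have hfun : (fun s : ℝ => (rowTermB n F j).realize (Sum.elim v (Function.update xs (Fin.castAdd (n * n) k) s))) =
      fun s : ℝ => (rowTerm n F j).realize (Sum.elim Empty.elim (Function.update (coordOf xs) k s)) := by
    funext s
    rw [realize_rowTermB, realize_rowTerm]
    congr 1
    exact Function.update_comp_eq_of_injective xs (Fin.castAdd_injective n (n * n)) k s
  rw [hfun] at h1
  exact h1.unique h2

/-- Semantics of `zeroB`. [folklore] -/
theorem realize_zeroB (v : Empty → ℝ) (xs : Fin (n + n * n) → ℝ) :
    (zeroB n F).Realize v xs ↔ ∀ i : Fin n, eval n (F.getD (i : ℕ) []) (coordOf xs) = 0 := by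
  rw [zeroB, realize_andL_map]
  simp only [List.mem_finRange, true_implies, BoundedFormula.realize_bdEqual, realize_rowTermB,
    Language.orderedExpRing.realize_zero]

/-- Semantics of `invEntryB`: the `(i, k)` entry of `B · Jac = 1`. [folklore] -/
theorem realize_invEntryB (v : Empty → ℝ) (xs : Fin (n + n * n) → ℝ) (i k : Fin n) :
    (invEntryB n F i k).Realize v xs ↔ (matOf xs * jac n F (coordOf xs)) i k = (1 : Matrix _ _ ℝ) i k := by
  rw [invEntryB, BoundedFormula.realize_bdEqual, Matrix.mul_apply, Fin.sum_univ_def, Matrix.one_apply]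
  simp only [realize_sumTerm, List.map_map, Function.comp_def, Language.orderedExpRing.realize_mul,
    realize_bv, realize_termPDeriv_rowTermB]
  constructor
  · intro h; rw [h]; split_ifs <;> simp
  · intro h; rw [h]; split_ifs <;> simp

/-- Semantics of `invB`: `B · Jac F(ā) = 1`. [folklore] -/
theorem realize_invB (v : Empty → ℝ) (xs : Fin (n + n * n) → ℝ) :
    (invB n F).Realize v xs ↔ matOf xs * jac n F (coordOf xs) = 1 := by
  rw [invB, realize_andL_map, ← Matrix.ext_iff]
  simp only [List.mem_finRange, true_implies, realize_andL_map, realize_invEntryB]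

/-- Semantics of `nonsingB`: common zero with a left inverse of the Jacobian. [folklore] -/
theorem realize_nonsingB (v : Empty → ℝ) (xs : Fin (n + n * n) → ℝ) :
    (nonsingB n F).Realize v xs ↔
      (∀ i : Fin n, eval n (F.getD (i : ℕ) []) (coordOf xs) = 0) ∧ matOf xs * jac n F (coordOf xs) = 1 := by
  rw [nonsingB, BoundedFormula.realize_inf, realize_zeroB, realize_invB]

/-- Semantics of `boundB`: all coordinates lie in `[-η, η]`. [folklore] -/
theorem realize_boundB (v : Empty → ℝ) (xs : Fin (n + n * n) → ℝ) :
    (boundB n η).Realize v xs ↔ ∀ i : Fin n, |coordOf xs i| ≤ η := by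
  rw [boundB, realize_andL_map]
  simp only [List.mem_finRange, true_implies, BoundedFormula.realize_inf, Term.realize_le,
    realize_xv, Language.orderedExpRing.realize_neg, realize_natTerm, abs_le]

/-- Semantics of the matrix `χ` of `σ_{F,η}`. [folklore] -/
theorem realize_chi (v : Empty → ℝ) (xs : Fin (n + n * n) → ℝ) :
    (chi n F η).Realize v xs ↔
      ((∀ i : Fin n, eval n (F.getD (i : ℕ) []) (coordOf xs) = 0) ∧
        matOf xs * jac n F (coordOf xs) = 1) → ∀ i : Fin n, |coordOf xs i| ≤ η := by
  rw [chi, BoundedFormula.realize_imp, realize_nonsingB, realize_boundB]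

variable (n F)

/-- the system `F` padded/truncated to exactly `n` rows (row `i` is `F.getD i []`) [folklore] -/
def pad : List ExpPolyCode := List.ofFn fun i : Fin n => F.getD (i : ℕ) []

/-- The padded system has exactly `n` rows. [folklore] -/
@[simp] theorem length_pad : (pad n F).length = n := by simp [pad]

/-- The rows of the padded system are those of the system (read with default `[]`). [folklore] -/
theorem getD_pad (i : Fin n) : (pad n F).getD (i : ℕ) [] = F.getD (i : ℕ) [] := by
  rw [List.getD_eq_getElem?_getD, pad, List.getElem?_ofFn]
  simp

/-- Padding does not change the row terms. [folklore] -/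
theorem rowTerm_pad (i : Fin n) : rowTerm n (pad n F) i = rowTerm n F i := by
  rw [rowTerm, rowTerm, getD_pad]

/-- Padding does not change the Jacobian. [folklore] -/
theorem jac_pad (x : Fin n → ℝ) : jac n (pad n F) x = jac n F x := by
  ext i j
  simp only [jac, Matrix.of_apply, pdTerm, rowTerm_pad]

/-- Non-singular zeros of the padded system, algebraically. [folklore] -/
theorem isNonsingularZero_pad_iff (a : Fin n → ℝ) :
    IsNonsingularZero n (pad n F) a ↔
      (∀ i : Fin n, eval n (F.getD (i : ℕ) []) a = 0) ∧ ∃ B : Matrix (Fin n) (Fin n) ℝ, B * jac n F a = 1 := by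
  rw [isNonsingularZero_iff, jac_pad]
  simp only [length_pad, getD_pad, true_and]

/-- A non-singular zero of `F` is one of the padded system. [folklore] -/
theorem isNonsingularZero_pad_of {a : Fin n → ℝ} (h : IsNonsingularZero n F a) :
    IsNonsingularZero n (pad n F) a := by
  rw [isNonsingularZero_pad_iff]
  exact ((isNonsingularZero_iff n F a).1 h).2

/-- **the set defined by `nonsingB`** projects onto the non-singular zeros of the padded system [folklore] -/
theorem setOf_isNonsingularZero_pad_eq :
    {a : Fin n → ℝ | IsNonsingularZero n (pad n F) a} =
      (fun xs : Fin (n + n * n) → ℝ => xs ∘ Fin.castAdd (n * n)) ''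
        {xs | (nonsingB n F).Realize default xs} := by
  ext a
  simp only [Set.mem_setOf_eq, isNonsingularZero_pad_iff, Set.mem_image, realize_nonsingB]
  constructor
  · rintro ⟨hz, B, hB⟩
    refine ⟨valOf a B, ⟨by simpa using hz, by simpa using hB⟩, ?_⟩
    exact coordOf_valOf a B
  · rintro ⟨xs, ⟨hz, hB⟩, rfl⟩
    exact ⟨hz, matOf xs, hB⟩

variable {n F}

/-- **The semantics of `σ_{F,η}` in `ℝ_exp`**: all non-singular zeros of the (padded) system have
coordinates of absolute value at most `η`. [folklore] -/
theorem realize_sigma_iff :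
    (ℝ ⊨ sigma n F η) ↔ ∀ a : Fin n → ℝ, IsNonsingularZero n (pad n F) a → ∀ i, |a i| ≤ η := by
  unfold sigma Sentence.Realize
  rw [BoundedFormula.realize_alls]
  simp only [realize_chi, isNonsingularZero_pad_iff]
  constructor
  · rintro h a ⟨hz, B, hB⟩ i
    have := h (valOf a B) ⟨by simpa using hz, by simpa using hB⟩ i
    simpa using this
  · rintro h xs ⟨hz, hB⟩ i
    exact h _ ⟨hz, _, hB⟩ i

/-- truth of `σ_{F,η}` bounds the genuine non-singular zeros [folklore] -/
theorem norm_lt_of_realize_sigma (h : ℝ ⊨ sigma n F η) {a : Fin n → ℝ} (ha : IsNonsingularZero n F a) :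
    ‖a‖ < η + 1 := by
  have hb := realize_sigma_iff.1 h a (isNonsingularZero_pad_of n F ha)
  have : ‖a‖ ≤ η := (pi_norm_le_iff_of_nonneg (Nat.cast_nonneg η)).2 fun i => by
    simpa [Real.norm_eq_abs] using hb i
  linarith

end Formulas

/-! ### Definability of the non-singular zeros (without parameters) -/

section Definable

variable (n : ℕ) (F : List ExpPolyCode)

/-- the set defined by `nonsingB` is definable without parameters [folklore] -/
theorem definable_setOf_nonsingB :
    (∅ : Set ℝ).Definable Language.orderedExpRing
      {xs : Fin (n + n * n) → ℝ | (nonsingB n F).Realize default xs} := by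
  refine Set.empty_definable_iff.2 ⟨(nonsingB n F).toFormula.relabel (Sum.elim Empty.elim id), ?_⟩
  ext xs
  simp only [Set.mem_setOf_eq, Formula.realize_relabel, BoundedFormula.realize_toFormula]
  have h1 : ((xs ∘ Sum.elim Empty.elim id) ∘ Sum.inl : Empty → ℝ) = default := funext fun e => e.elim
  have h2 : ((xs ∘ Sum.elim Empty.elim id) ∘ Sum.inr : Fin (n + n * n) → ℝ) = xs := funext fun _ => rfl
  rw [h1, h2]

/-- **the set of non-singular zeros of the padded system is definable without parameters** (a
projection of the set defined by `nonsingB`) [folklore] -/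
theorem definable_setOf_isNonsingularZero_pad :
    (∅ : Set ℝ).Definable Language.orderedExpRing {a : Fin n → ℝ | IsNonsingularZero n (pad n F) a} := by
  rw [setOf_isNonsingularZero_pad_eq]
  exact (definable_setOf_nonsingB n F).image_comp (Fin.castAdd (n * n))

/-- the set of non-singular zeros of a system is definable without parameters [folklore] -/
theorem definable_setOf_isNonsingularZero :
    (∅ : Set ℝ).Definable Language.orderedExpRing {a : Fin n → ℝ | IsNonsingularZero n F a} := by
  by_cases hF : F.length = n
  · have : {a : Fin n → ℝ | IsNonsingularZero n F a} = {a | IsNonsingularZero n (pad n F) a} := by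
      ext a
      rw [Set.mem_setOf_eq, Set.mem_setOf_eq, isNonsingularZero_pad_iff, isNonsingularZero_iff]
      simp [hF]
    rw [this]
    exact definable_setOf_isNonsingularZero_pad n F
  · have : {a : Fin n → ℝ | IsNonsingularZero n F a} = ∅ := by
      ext a; simp [isNonsingularZero_iff, hF]
    rw [this]
    exact Set.definable_empty

/-- hence each coordinate projection of it is a parametrically definable subset of the line [folklore] -/
theorem definable₁_image_isNonsingularZero (i : Fin n) :
    (Set.univ : Set ℝ).Definable₁ Language.orderedExpRing
      ((fun a : Fin n → ℝ => a i) '' {a : Fin n → ℝ | IsNonsingularZero n F a}) := by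
  have h := ((definable_setOf_isNonsingularZero n F).image_comp (fun _ : Fin 1 => i)).mono
    (Set.empty_subset Set.univ)
  unfold Set.Definable₁
  convert h using 1
  ext v
  simp only [Set.mem_image, Set.mem_setOf_eq]
  constructor
  · rintro ⟨a, ha, hv⟩
    exact ⟨a, ha, funext fun k => by fin_cases k; simpa using hv⟩
  · rintro ⟨a, ha, rfl⟩
    exact ⟨a, ha, rfl⟩

end Definable

/-! ### Analysis: non-singular zeros are isolated, hence countably many -/

section Analysis

open Topology Filter

variable (n : ℕ) (F : List ExpPolyCode)

/-- **Inverse function theorem step.** Near a non-singular zero the system takes the value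
`F(ā)` only at `ā`. [folklore] -/
theorem eventually_eq_of_isNonsingularZero {a : Fin n → ℝ} (ha : IsNonsingularZero n F a) :
    ∀ᶠ x in 𝓝 a, sysMap n F x = sysMap n F a → x = a := by
  obtain ⟨_, _, hdet⟩ := ha
  have hstrict : HasStrictFDerivAt (sysMap n F) (fderiv ℝ (sysMap n F) a) a :=
    (contDiff_sysMap n F).contDiffAt.hasStrictFDerivAt (by simp)
  let e : (Fin n → ℝ) ≃L[ℝ] (Fin n → ℝ) :=
    (LinearMap.equivOfDetNeZero
      (fderiv ℝ (sysMap n F) a : (Fin n → ℝ) →ₗ[ℝ] (Fin n → ℝ)) hdet).toContinuousLinearEquiv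
  have he : (e : (Fin n → ℝ) →L[ℝ] (Fin n → ℝ)) = fderiv ℝ (sysMap n F) a := by
    ext v i
    simp [e, LinearMap.equivOfDetNeZero]
  have hstrict' : HasStrictFDerivAt (sysMap n F) (e : (Fin n → ℝ) →L[ℝ] (Fin n → ℝ)) a := by
    rw [he]; exact hstrict
  filter_upwards [hstrict'.eventually_left_inverse] with x hx hfx
  rw [← hx, hfx]
  exact hstrict'.localInverse_apply_image

/-- hence every non-singular zero has a ball around it containing no other non-singular zero [folklore] -/
theorem exists_ball_inter_eq_singleton {a : Fin n → ℝ} (ha : IsNonsingularZero n F a) :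
    ∃ ε > 0, ∀ b, IsNonsingularZero n F b → dist b a < ε → b = a := by
  obtain ⟨ε, hε, h⟩ := Metric.eventually_nhds_iff.1 (eventually_eq_of_isNonsingularZero n F ha)
  refine ⟨ε, hε, fun b hb hba => h hba ?_⟩
  rw [hb.2.1, ha.2.1]

/-- **The non-singular zeros of an `n × n` system form a countable set** (they are isolated, and
`ℝⁿ` is separable: the half-radius isolating balls are pairwise disjoint open sets). [folklore] -/
theorem countable_setOf_isNonsingularZero :
    {a : Fin n → ℝ | IsNonsingularZero n F a}.Countable := by
  classical
  choose! ε hε hiso using fun a (ha : IsNonsingularZero n F a) => exists_ball_inter_eq_singleton n F ha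
  refine Set.PairwiseDisjoint.countable_of_isOpen (s := fun a => Metric.ball a (ε a / 2))
    (fun a ha b hb hab => ?_) (fun a _ => Metric.isOpen_ball) (fun a ha => ⟨a, Metric.mem_ball_self (half_pos (hε a ha))⟩)
  refine Set.disjoint_left.2 fun x hxa hxb => hab ?_
  rw [Metric.mem_ball] at hxa hxb
  rcases le_total (ε b) (ε a) with hle | hle
  · refine (hiso a ha b hb ?_).symm
    calc dist b a ≤ dist b x + dist x a := dist_triangle _ _ _
      _ < ε b / 2 + ε a / 2 := by rw [dist_comm b x]; exact add_lt_add hxb hxa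
      _ ≤ ε a / 2 + ε a / 2 := by gcongr
      _ = ε a := by ring
  · exact hiso b hb a ha (by
      calc dist a b ≤ dist a x + dist x b := dist_triangle _ _ _
        _ < ε a / 2 + ε b / 2 := by rw [dist_comm a x]; exact add_lt_add hxa hxb
        _ ≤ ε b / 2 + ε b / 2 := by gcongr
        _ = ε b := by ring)

end Analysis

end ExpPolyCode

/-! ### O-minimality: countable definable subsets of the line are bounded -/

section OMinimal

open Filter Set

namespace IsFiniteUnionOfIntervals

variable {M : Type*} [LinearOrder M] {s : Set M}

/-- the twin at `-∞` of `eventually_mem_or_eventually_notMem` (`OMinimalExamples.lean`): a finite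
union of points and intervals is eventually constant at `-∞`. [cite: Dries1998, Ch. 1 (4.2), proof of the Lemma] -/
theorem eventually_mem_or_eventually_notMem_atBot (hs : IsFiniteUnionOfIntervals s) :
    (∀ᶠ x in atBot, x ∈ s) ∨ (∀ᶠ x in atBot, x ∉ s) := by
  induction hs using BooleanSubalgebra.closure_bot_sup_induction with
  | mem s hs =>
    rcases hs with ⟨a, rfl⟩ | ⟨a, rfl⟩
    · by_cases ha : IsMin a
      · exact Or.inr (Eventually.of_forall fun x (hx : x < a) => ha.not_lt hx)
      · obtain ⟨b, hb⟩ := not_isMin_iff.1 ha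
        exact Or.inl ((eventually_le_atBot b).mono fun x hx => lt_of_le_of_lt hx hb)
    · exact Or.inr ((eventually_le_atBot a).mono fun x hx => not_lt.2 hx)
  | bot => exact Or.inr (Eventually.of_forall fun x hx => hx)
  | sup s _ t _ ihs iht =>
    rcases ihs with hs | hs
    · exact Or.inl (hs.mono fun x hx => Or.inl hx)
    · rcases iht with ht | ht
      · exact Or.inl (ht.mono fun x hx => Or.inr hx)
      · exact Or.inr ((hs.and ht).mono fun x hx h => h.elim hx.1 hx.2)
  | compl s _ ih =>
    rcases ih with h | h
    · exact Or.inr (h.mono fun x hx hxc => hxc hx)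
    · exact Or.inl h

end IsFiniteUnionOfIntervals

/-- rays of `ℝ` are uncountable [folklore] -/
theorem not_countable_Ici_real (b : ℝ) : ¬ (Set.Ici b).Countable := fun h => by
  have h1 : Cardinal.mk (Set.Ici b) ≤ Cardinal.aleph0 := Cardinal.mk_le_aleph0_iff.2 h.to_subtype
  rw [Cardinal.mk_Ici_real] at h1
  exact not_le_of_gt Cardinal.aleph0_lt_continuum h1

/-- left rays of `ℝ` are uncountable [folklore] -/
theorem not_countable_Iic_real (b : ℝ) : ¬ (Set.Iic b).Countable := fun h => by
  have h1 : Cardinal.mk (Set.Iic b) ≤ Cardinal.aleph0 := Cardinal.mk_le_aleph0_iff.2 h.to_subtype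
  rw [Cardinal.mk_Iic_real] at h1
  exact not_le_of_gt Cardinal.aleph0_lt_continuum h1

open FirstOrder in
/-- **In an o-minimal expansion of `(ℝ, <)`, a countable parametrically definable subset of the
line is bounded** (it is a finite union of points and intervals, and an unbounded one contains a
ray, which is uncountable). [cite: Dries1998, Ch. 1 (3.2)] -/
theorem bddAbove_and_bddBelow_of_isOMinimal {L : FirstOrder.Language} [L.Structure ℝ]
    (hO : L.IsOMinimal ℝ) {T : Set ℝ} (hT : (Set.univ : Set ℝ).Definable₁ L T)
    (hc : T.Countable) : BddAbove T ∧ BddBelow T := by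
  have hfin : IsFiniteUnionOfIntervals T := hO T hT
  constructor
  · rcases hfin.eventually_mem_or_eventually_notMem with h | h
    · exfalso
      obtain ⟨b, hb⟩ := eventually_atTop.1 h
      exact not_countable_Ici_real b (hc.mono fun x hx => hb x hx)
    · obtain ⟨b, hb⟩ := eventually_atTop.1 h
      exact ⟨b, fun x hx => le_of_not_gt fun hbx => hb x hbx.le hx⟩
  · rcases hfin.eventually_mem_or_eventually_notMem_atBot with h | h
    · exfalso
      obtain ⟨b, hb⟩ := eventually_atBot.1 h
      exact not_countable_Iic_real b (hc.mono fun x hx => hb x hx)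
    · obtain ⟨b, hb⟩ := eventually_atBot.1 h
      exact ⟨b, fun x hx => le_of_not_gt fun hbx => hb x hbx.le hx⟩

end OMinimal

/-! ### Assembly: o-minimality of `ℝ_exp` bounds the non-singular zeros of every system -/

namespace ExpPolyCode

open FirstOrder

/-- **The Last Root Conjecture without effectivity.** If `ℝ_exp` is o-minimal (Wilkie's theorem),
then for every `n` and every `n × n` system `F` of exponential polynomials over `ℤ` there is a
bound `η ∈ ℕ` on the sup norm of all its non-singular zeros; the content of the Last Root Conjecture
is thus exactly the *computability* of such a bound as a function of the system. [cite: BerarducciServi2004, p. 44] -/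
theorem exists_bound_isNonsingularZero (hO : Language.orderedExpRing.IsOMinimal ℝ) (n : ℕ)
    (F : List ExpPolyCode) : ∃ η : ℕ, ∀ a : Fin n → ℝ, IsNonsingularZero n F a → ‖a‖ < η := by
  have hbd : ∀ i : Fin n, ∃ R : ℝ, ∀ a, IsNonsingularZero n F a → |a i| ≤ R := fun i => by
    obtain ⟨⟨u, hu⟩, ⟨l, hl⟩⟩ := bddAbove_and_bddBelow_of_isOMinimal hO
      (definable₁_image_isNonsingularZero n F i) ((countable_setOf_isNonsingularZero n F).image _)
    refine ⟨max |u| |l|, fun a ha => ?_⟩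
    have h1 : a i ≤ u := hu ⟨a, ha, rfl⟩
    have h2 : l ≤ a i := hl ⟨a, ha, rfl⟩
    rw [abs_le]
    constructor
    · have : -|l| ≤ l := neg_abs_le l
      have : |l| ≤ max |u| |l| := le_max_right _ _
      linarith
    · exact h1.trans ((le_abs_self u).trans (le_max_left _ _))
  choose R hR using hbd
  refine ⟨⌊∑ j, |R j|⌋₊ + 1, fun a ha => ?_⟩
  have hsum : ∀ i, |a i| ≤ ∑ j, |R j| := fun i =>
    ((hR i a ha).trans (le_abs_self _)).trans
      (Finset.single_le_sum (fun j _ => abs_nonneg (R j)) (Finset.mem_univ i))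
  have hnorm : ‖a‖ ≤ ∑ j, |R j| :=
    (pi_norm_le_iff_of_nonneg (Finset.sum_nonneg fun j _ => abs_nonneg (R j))).2
      fun i => by simpa [Real.norm_eq_abs] using hsum i
  calc ‖a‖ ≤ ∑ j, |R j| := hnorm
    _ < ⌊∑ j, |R j|⌋₊ + 1 := Nat.lt_floor_add_one _
    _ = ((⌊∑ j, |R j|⌋₊ + 1 : ℕ) : ℝ) := by push_cast; ring

/-- for every system some `σ_{F,η}` is true in `ℝ_exp`, granted o-minimality [folklore] -/
theorem exists_realize_sigma (hO : Language.orderedExpRing.IsOMinimal ℝ) (n : ℕ) (F : List ExpPolyCode) :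
    ∃ η : ℕ, ℝ ⊨ sigma n F η := by
  obtain ⟨η, hη⟩ := exists_bound_isNonsingularZero hO n (pad n F)
  refine ⟨η, realize_sigma_iff.2 fun a ha i => ?_⟩
  have h := hη a ha
  have hi : |a i| ≤ ‖a‖ := by simpa [Real.norm_eq_abs] using norm_le_pi_norm a i
  exact hi.trans h.le

end ExpPolyCode

/-- **The Last Root Conjecture without effectivity, from Wilkie's theorem** (the named fact
`Literature.ModelTheory.ExponentialFields.wilkie_isOMinimal`: `ℝ_exp` is o-minimal): every `n × n` system of exponential polynomials
over `ℤ` has a bound in `ℕ` on the sup norm of its non-singular real zeros — what it lacks with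
respect to `Literature.ModelTheory.ExponentialFields.LastRootConjecture` is the computability of the bound as a function of the system
(Berarducci–Servi 2004, p. 44, remark after the Last Root Conjecture, there via Khovanskii's
finiteness theorem). [cite: BerarducciServi2004, p. 44] -/
theorem exists_bound_isNonsingularZero_of_wilkie_isOMinimal (hO : wilkie_isOMinimal) (n : ℕ)
    (F : List ExpPolyCode) :
    ∃ η : ℕ, ∀ a : Fin n → ℝ, ExpPolyCode.IsNonsingularZero n F a → ‖a‖ < η :=
  ExpPolyCode.exists_bound_isNonsingularZero hO n F

end Literature.ModelTheory.ExponentialFields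
end
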